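import Summits.Parity.BatemanHorn.Theorems.AlmostPrimeZerosSystemZeroRepulsionApTwistedEulerCore

/-!
# The twisted capped Euler product, II: engine data (stub `stub_apTwistedEulerData`)

Line `smooth-rough-lattice-acquisition` of crux stmt-Parity-11291
(`Summit.Parity.BatemanHorn.Theses.AlmostPrimeZeros.SystemZeroRepulsion`), class `linₐ`.

Part I (`AlmostPrimeZerosSystemZeroRepulsionApTwistedEulerCore.lean`,
`stub_apTwistedEulerDataCore`) gives, for a Dirichlet character `χ mod q` and
`a(n) = χ(n) z^{s(n)}` (`s(n) = Σ_{p^v ∥ n} min(v,2)`), a holomorphic `G` on `σ > 1/2` with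
`Σ a(n) n^{-s} = exp(z Σ_p −Log(1 − χ(p)p^{-s})) G(s)` (`σ > 1`), `‖G‖ ≤ e^{b₀(1+R)^{3/2}}` on
`σ > 4/5` and the majorant `Σ ‖a(n)‖ n^{-σ} ≤ e^{b₀(1+R)^{3/2}} (σ−1)^{-R}` (`1 < σ ≤ 2`).
Here we add the principal character: since `χ₀(p) = [p ∤ q]`,
`Σ_p −Log(1 − χ₀(p) p^{-s}) = Σ_p −Log(1 − p^{-s}) + Σ_{p ∣ q} Log(1 − p^{-s})`
(`tsum_neg_log_one_sub_twist_one`), so `Σ a(n) n^{-s} = ζ(s)^z G₁(s)` with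
`G₁ = G · exp(z Σ_{p ∣ q} Log(1 − p^{-s}))`, holomorphic on `σ > 1/2` and bounded by
`e^{b₀(1+R)^{3/2}} e^{2 ω(q) |z|}` on `σ > 4/5` (`‖Log(1 − p^{-s})‖ ≤ 2` there): the hypotheses
`SelbergDelange.RieszData R (4/5) B z a G₁` of the tree's `ζ^z` contour engine, with the single
constant `b = b₀ + 2 ω(q)` — **`stub_apTwistedEulerData`**.

Theorem-only file (no definitions). References: H. L. Montgomery, R. C. Vaughan,
*Multiplicative Number Theory I*, CUP 2007, §7.4, §11.3; G. Tenenbaum, *Introduction to analytic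
and probabilistic number theory*, 3rd ed., II.5.
-/

noncomputable section

open Complex LSeries Filter Topology Finset
open Literature.NumberTheory.LFunctions
open Summit.Parity.BatemanHorn.Cruxes.LinearCappedRepulsion.JensenStieltjesMajorant

namespace Summit.Parity.BatemanHorn.Cruxes.SystemZeroRepulsion.NearFar

namespace ApTwistedEuler

/-! ### The principal character: reduction to `ζ(s)^z` -/

/-- For the principal character `χ₀ mod q` (`q ≥ 1`) and `σ > 1`:
`Σ_p −Log(1 − χ₀(p) p^{-s}) = Σ_p −Log(1 − p^{-s}) + Σ_{p ∣ q} Log(1 − p^{-s})`. -/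
theorem tsum_neg_log_one_sub_twist_one (q : ℕ) [NeZero q] {s : ℂ} (hs : 1 < s.re) :
    ∑' p : Nat.Primes, -log (1 - (1 : DirichletCharacter ℂ q) p * (p : ℂ) ^ (-s)) =
      eulerLogZeta s + ∑ p ∈ q.primeFactors, log (1 - (p : ℂ) ^ (-s)) := by
  have hq0 : q ≠ 0 := NeZero.ne q
  set g : ℕ → ℂ := fun n ↦ if n ∣ q then log (1 - (n : ℂ) ^ (-s)) else 0 with hg
  -- the finitely supported correction
  have hcorr : HasSum (fun p : Nat.Primes ↦ g p)
      (∑ p ∈ q.primeFactors, log (1 - (p : ℂ) ^ (-s))) := by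
    have h : HasSum (fun p : {p : ℕ // p.Prime} ↦ g p)
        (∑ p ∈ q.primeFactors.subtype Nat.Prime, g p) :=
      hasSum_sum_of_ne_finset_zero fun p hp ↦ by
        rw [hg]
        dsimp only
        rw [if_neg]
        intro hdvd
        exact hp (Finset.mem_subtype.2 (Nat.mem_primeFactors.2 ⟨p.prop, hdvd, hq0⟩))
    have e : ∑ p ∈ q.primeFactors, g p = ∑ p ∈ q.primeFactors, log (1 - (p : ℂ) ^ (-s)) :=
      Finset.sum_congr rfl fun p hp ↦ if_pos (Nat.dvd_of_mem_primeFactors hp)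
    rw [Finset.sum_subtype_of_mem (p := Nat.Prime) g fun p hp ↦ Nat.prime_of_mem_primeFactors hp,
      e] at h
    exact h
  have h3 : HasSum
      (fun p : Nat.Primes ↦ -log (1 - (1 : DirichletCharacter ℂ q) p * (p : ℂ) ^ (-s)))
      (eulerLogZeta s + ∑ p ∈ q.primeFactors, log (1 - (p : ℂ) ^ (-s))) := by
    convert (SatheSelberg.hasSum_eulerLogZeta hs).add hcorr using 1
    funext p
    rw [hg]
    dsimp only
    by_cases hp : (p : ℕ) ∣ q
    · rw [MulChar.map_nonunit _ (by rwa [ZMod.isUnit_prime_iff_not_dvd p.prop, not_not]),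
        zero_mul, sub_zero, log_one, neg_zero, if_pos hp, neg_add_cancel]
    · rw [MulChar.one_apply ((ZMod.isUnit_prime_iff_not_dvd p.prop).2 hp), one_mul, if_neg hp,
        add_zero]
  exact h3.tsum_eq

/-- The correction factor `exp(z Σ_{p ∣ q} Log(1 − p^{-s}))` is holomorphic on `σ > 0`. -/
theorem differentiableAt_corr (q : ℕ) (z : ℂ) {s : ℂ} (hs : 0 < s.re) :
    DifferentiableAt ℂ
      (fun s : ℂ ↦ exp (z * ∑ p ∈ q.primeFactors, log (1 - (p : ℂ) ^ (-s)))) s := by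
  refine ((differentiableAt_const z).mul (DifferentiableAt.fun_sum fun p hp ↦ ?_)).cexp
  have hp := Nat.prime_of_mem_primeFactors hp
  have hq : DifferentiableAt ℂ (fun w : ℂ ↦ 1 - (p : ℂ) ^ (-w)) s :=
    (differentiableAt_const _).sub
      (differentiableAt_id.neg.const_cpow (Or.inl (by exact_mod_cast hp.ne_zero)))
  exact hq.clog (SatheSelberg.one_sub_prime_cpow_mem_slitPlane ⟨p, hp⟩ hs)

/-- The correction factor is bounded: `‖exp(z Σ_{p ∣ q} Log(1 − p^{-s}))‖ ≤ exp(2 ω(q) ‖z‖)` for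
`σ ≥ 1/2` (`‖Log(1 − p^{-s})‖ ≤ 2` as `‖p^{-s}‖ ≤ 3/4`). -/
theorem norm_corr_le (q : ℕ) (z : ℂ) {s : ℂ} (hs : 1 / 2 ≤ s.re) :
    ‖exp (z * ∑ p ∈ q.primeFactors, log (1 - (p : ℂ) ^ (-s)))‖ ≤
      Real.exp (‖z‖ * (2 * q.primeFactors.card)) := by
  refine (norm_exp_le_exp_norm _).trans (Real.exp_le_exp.2 ?_)
  rw [norm_mul]
  refine mul_le_mul_of_nonneg_left ((norm_sum_le _ _).trans ?_) (norm_nonneg _)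
  have h2 : ∀ p ∈ q.primeFactors, ‖log (1 - (p : ℂ) ^ (-s))‖ ≤ 2 := fun p hp ↦ by
    have hp := Nat.prime_of_mem_primeFactors hp
    have ht : ‖(p : ℂ) ^ (-s)‖ ≤ 3 / 4 := CappedEuler.norm_primes_cpow_le ⟨p, hp⟩ hs
    have ht0 : 0 ≤ ‖(p : ℂ) ^ (-s)‖ := norm_nonneg _
    have h := norm_log_one_add_le (z := -(p : ℂ) ^ (-s)) (by rw [norm_neg]; linarith)
    rw [norm_neg, ← sub_eq_add_neg] at h
    have h4 : (1 - ‖(p : ℂ) ^ (-s)‖)⁻¹ ≤ 4 := by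
      rw [inv_le_comm₀ (by linarith) (by norm_num)]; linarith
    have h5 : 0 ≤ (1 - ‖(p : ℂ) ^ (-s)‖)⁻¹ := inv_nonneg.2 (by linarith)
    have h6 : ‖(p : ℂ) ^ (-s)‖ ^ 2 * (1 - ‖(p : ℂ) ^ (-s)‖)⁻¹ ≤ (3 / 4) ^ 2 * 4 :=
      mul_le_mul (pow_le_pow_left₀ ht0 ht 2) h4 h5 (by norm_num)
    linarith
  calc ∑ p ∈ q.primeFactors, ‖log (1 - (p : ℂ) ^ (-s))‖ ≤ ∑ p ∈ q.primeFactors, (2 : ℝ) :=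
        Finset.sum_le_sum h2
    _ = 2 * q.primeFactors.card := by rw [Finset.sum_const, nsmul_eq_mul]; ring

end ApTwistedEuler

open ApTwistedEuler in
/-- **Stub A (the twisted capped Euler product as engine data), PROVED.**  For a Dirichlet
character `χ mod q` there is `b ≥ 0` (namely `b = b₀ + 2 ω(q)`, `b₀ = 30 Σ_p p^{-6/5} + 1`) such
that for every `R ≥ 0`, `‖z‖ ≤ R`, the coefficients `a(n) = χ(n) z^{s(n)}` and the product
`G(s) = ∏_p (1 + z w_p + z² w_p²/(1 − w_p))·exp(z·Log(1 − w_p))`, `w_p = χ(p) p^{-s}`, satisfy: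
`G` is holomorphic on `σ > 1/2` with `‖G‖ ≤ B = exp(b (1+R)^{3/2})` on `σ > 4/5`; `Σ a(n) n^{-s}`
converges absolutely and equals `exp(z Σ_p −Log(1 − w_p)) G(s)` for `σ > 1`;
`Σ ‖a(n)‖ n^{-σ} ≤ B (σ − 1)^{-R}` for `1 < σ ≤ 2`; and, for `χ = χ₀`, the data
`SelbergDelange.RieszData R (4/5) B z a (G · exp(z Σ_{p∣q} Log(1 − p^{-s})))` of the `ζ^z`
engine. -/
theorem stub_apTwistedEulerData :
    ∀ (q : ℕ) [NeZero q] (χ : DirichletCharacter ℂ q), ∃ b : ℝ, 0 ≤ b ∧ ∀ R : ℝ, 0 ≤ R → ∀ z : ℂ, ‖z‖ ≤ R →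
      ∃ G : ℂ → ℂ, DifferentiableOn ℂ G {s : ℂ | 1 / 2 < s.re} ∧
        (∀ s : ℂ, 4 / 5 < s.re → ‖G s‖ ≤ Real.exp (b * (1 + R) ^ (3 / 2 : ℝ))) ∧
        (∀ σ : ℝ, 1 < σ →
          LSeriesSummable (fun n : ℕ => χ (n : ZMod q) * z ^ (n.factorization.sum fun _ v => min v 2)) σ) ∧
        (∀ s : ℂ, 1 < s.re →
          LSeries (fun n : ℕ => χ (n : ZMod q) * z ^ (n.factorization.sum fun _ v => min v 2)) s =
            Complex.exp (z * ∑' p : Nat.Primes, -Complex.log (1 - χ ((p : ℕ) : ZMod q) * ((p : ℕ) : ℂ) ^ (-s))) * G s) ∧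
        (∀ σ : ℝ, 1 < σ → σ ≤ 2 →
          ∑' n : ℕ, ‖LSeries.term (fun n : ℕ => χ (n : ZMod q) * z ^ (n.factorization.sum fun _ v => min v 2)) σ n‖ ≤
            Real.exp (b * (1 + R) ^ (3 / 2 : ℝ)) / (σ - 1) ^ R) ∧
        (χ = 1 → Literature.NumberTheory.LFunctions.SelbergDelange.RieszData R (4 / 5) (Real.exp (b * (1 + R) ^ (3 / 2 : ℝ))) z
          (fun n : ℕ => χ (n : ZMod q) * z ^ (n.factorization.sum fun _ v => min v 2))
          (fun s : ℂ => G s * Complex.exp (z * ∑ p ∈ q.primeFactors, Complex.log (1 - ((p : ℕ) : ℂ) ^ (-s))))) := by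
  intro q _ χ
  obtain ⟨b₀, hb₀, H⟩ := stub_apTwistedEulerDataCore q χ
  set k : ℝ := (q.primeFactors.card : ℝ) with hk
  have hk0 : 0 ≤ k := Nat.cast_nonneg _
  refine ⟨b₀ + 2 * k, by positivity, fun R hR z hz ↦ ?_⟩
  obtain ⟨G, hdiff, hG, hsum, hL, hmaj⟩ := H R hR z hz
  set M : ℝ := (1 + R) ^ (3 / 2 : ℝ) with hM
  have hM1 : 1 + R ≤ M := Real.self_le_rpow_of_one_le (by linarith) (by norm_num)
  have hB : Real.exp (b₀ * M) ≤ Real.exp ((b₀ + 2 * k) * M) := Real.exp_le_exp.2 (by nlinarith)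
  have hmaj' : ∀ σ : ℝ, 1 < σ → σ ≤ 2 →
      ∑' n : ℕ, ‖term (fun n : ℕ ↦ χ n * z ^ (n.factorization.sum fun _ v => min v 2)) σ n‖ ≤
        Real.exp ((b₀ + 2 * k) * M) / (σ - 1) ^ R := fun σ hσ hσ2 ↦
    (hmaj σ hσ hσ2).trans (div_le_div_of_nonneg_right hB (Real.rpow_nonneg (by linarith) R))
  refine ⟨G, hdiff, fun s hs ↦ (hG s hs).trans hB, hsum, hL, hmaj', fun hχ ↦ ?_⟩
  subst hχ
  refine ⟨hz, fun s hs ↦ ?_, fun s hs ↦ ?_, hsum, fun s hs ↦ ?_, hmaj'⟩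
  · -- holomorphy on `σ > 4/5`
    have hs' : 4 / 5 < s.re := hs
    have h1 := hdiff.differentiableAt
      ((isOpen_lt continuous_const continuous_re).mem_nhds (show 1 / 2 < s.re by linarith))
    exact (h1.mul (differentiableAt_corr q z (by linarith))).differentiableWithinAt
  · -- the bound on `σ > 4/5`
    rw [norm_mul]
    have hzM : ‖z‖ * (2 * k) ≤ 2 * k * M := by nlinarith [norm_nonneg z]
    calc _ ≤ Real.exp (b₀ * M) * Real.exp (‖z‖ * (2 * k)) :=
          mul_le_mul (hG s hs) (norm_corr_le q z (by linarith)) (norm_nonneg _) (Real.exp_nonneg _)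
      _ ≤ Real.exp ((b₀ + 2 * k) * M) := by
          rw [← Real.exp_add, Real.exp_le_exp]; nlinarith
  · -- `Σ a(n) n^{-s} = ζ(s)^z G₁(s)`
    rw [hL s hs, tsum_neg_log_one_sub_twist_one q hs, mul_add, exp_add,
      SelbergDelange.zetaPow_eq_exp_eulerLogZeta z hs]
    ring

end Summit.Parity.BatemanHorn.Cruxes.SystemZeroRepulsion.NearFar
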